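import Literature.Analysis.FluidPDE.GIPGlobalStabilityProofs
import Literature.Analysis.FluidPDE.NSKatoToClayHolds
import Literature.Analysis.FluidPDE.AxisymmetricNoSwirlGlobalHolds
import Literature.Analysis.FluidPDE.TaoFiniteEnergyLerayHopf
import Literature.Analysis.FluidPDE.NormalisedPressureDischarge
import Literature.Analysis.FluidPDE.NSFiniteEnergySmoothProofs
import Literature.Analysis.FluidPDE.NSCriticalClosureBesovKatoClass
import Literature.Analysis.FluidPDE.KatoL3Uniqueness
import Literature.Analysis.FluidPDE.KatoMaximalTime
import Literature.Analysis.FluidPDE.BoundedLerayHopfClay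
import Literature.Analysis.FluidPDE.NSLerayHopf

/-!
# GLOBAL REGULARITY IS OPEN IN `L³` AROUND EVERY SWIRL-FREE AXISYMMETRIC DATUM (all three ingredients are tree theorems)

Cell `ns-blowup`, seat `cstrat-stmt-NavierStokesRegularity-19179` (g2; crux-strategist beside the LEAD of
stmt-NavierStokesRegularity-20303 `EpisodeBaseT`, route `PalasekTowerBreakdown` rev 19). Negative-lane SUPPORT for the
heredity pair stmt-…-20304 `HeredityAtOneT` / -20305 `HeredityFromTwoT` and their SHELF twins `LiveHeredityAtGAt` /
`LiveHeredityFromGAt` (p530059): it is stub **S2** of the strategist's «ROBUST MIRROR» line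
(`Cruxes/EpisodeBase/Lines/robustmirror.lean`), now DISCHARGED. No `Theses` import, no stage / register / run.

THE THEOREM (`exists_L3_ball_global_classical_of_axisym_noSwirl`). Let `u₀ : ℝ³ → ℝ³` be smooth, divergence free,
rapidly decaying, axisymmetric and swirl free. Then there is `ε > 0` such that EVERY smooth divergence-free rapidly
decaying `a` with `‖a − u₀‖_{L³} < ε` — no symmetry asked of `a` — has a global classical bounded-energy solution
`(U, P)` of the unit-viscosity unforced Navier–Stokes system on `[0, ∞) × ℝ³` with `U 0 = a`.

PROOF = three tree theorems glued: (1) Ladyzhenskaya–Ukhovskii–Yudovich (`axisymmetric_no_swirl_global_regularity_holds`):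
`u₀` has a global classical bounded-energy solution; (2) **`hasGlobalKatoSolution_of_global_classical`** (this file,
the missing glue): a global classical bounded-energy solution from a rapidly decaying datum is a global Kato `C_t L³`
solution — on each `[0, T]` it is Leray–Hopf (Tao 2011 Lemma 8.1, `IsClassicalNSSolutionOn.isLerayHopfOn_of_finiteEnergy`
with the three discharged facts), hence Kato on `[0, T)` (`isKatoSolutionOn_of_classical`, Lemarié-Rieusset Thm 15.1), so
`T_max^{Kato}(u₀) = ∞` and the Kato solutions glue (`hasGlobalKatoSolution_of_katoMaximalTime_eq_top kato_unique_holds`);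
(3) Gallagher–Iftimie–Planchon 2003 Thm 0.1 (`GIP2003_L3_stability_holds`, corollary
`exists_ball_hasGlobalKatoSolution_one`): global Kato data are OPEN in `L³`; and back to Clay-class classical solutions by
`clay_solution_of_hasGlobalKatoSolution_holds` + `isNavierStokesSolution_and_smooth_iff`.

WHY IT MATTERS HERE (see the line card `Cruxes/EpisodeBase/Lines/robustmirror.md`): a tuned design whose datum lies in
that `L³`-ball and which registers level 1 has, by `Schedule.exists_last_level_of_global_classical`, a LAST registered
level — so if ONE swirl-free unforced design registers level 1 with slack, an `L³`-open set of LIVE (helicity `≠ 0`)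
globally regular designs registers too, and no nowhere-dense «live-class» excision repairs the heredity pair.

WHAT THIS IS NOT: nothing about stages or blow-up; 20303/20304/20305 stay OPEN; no new analysis — bookkeeping over
LUY 1968, GIP 2003, Kato 1984, Tao 2011, all already kernel-checked in `Literature/`.
-/

noncomputable section

namespace Summit.NavierStokesRegularity.SterileGlobalOpenL3

open Set MeasureTheory Filter Topology Function
open scoped ENNReal NNReal ContDiff
open Literature.Analysis.FluidPDE

/-- A smooth rapidly decaying field is in `L³` (interpolation `‖a‖₃³ ≤ ‖a‖_∞ ‖a‖₂²`, as in
`clay_solution_of_locallyBounded_globalLerayHopf`). [cite: GallagherIftimiePlanchon2003, Thm. 0.1 (p. 1389)] -/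
theorem memLp_three_of_contDiff_of_hasRapidSpatialDecay {a : EuclideanSpace ℝ (Fin 3) → EuclideanSpace ℝ (Fin 3)}
    (ha : ContDiff ℝ ∞ a) (hdec : HasRapidSpatialDecay a) : MemLp a 3 volume := by
  have hHk : ∀ n : ℕ, ∫⁻ x, ‖iteratedFDeriv ℝ n a x‖ₑ ^ 2 < ⊤ :=
    hdec.lintegral_enorm_iteratedFDeriv_sq_lt_top
  have hmeas0 : AEStronglyMeasurable a volume := ha.continuous.aestronglyMeasurable
  have hL2 : ∫⁻ x, ‖a x‖ₑ ^ 2 < ⊤ := by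
    refine lt_of_le_of_lt (le_of_eq (lintegral_congr fun x => ?_)) (hHk 0)
    rw [← ofReal_norm, ← ofReal_norm, norm_iteratedFDeriv_zero]
  have hu2 : MemLp a 2 volume := ⟨hmeas0, eLpNorm_two_lt_top_of_lintegral_enorm_sq_lt_top hL2⟩
  obtain ⟨C₀, hC₀⟩ := hdec 0 0
  have hbd0 : ∀ x, ‖a x‖ ≤ C₀ := fun x => by
    have h := hC₀ x
    rwa [pow_zero, one_mul, norm_iteratedFDeriv_zero] at h
  refine ⟨hmeas0, ?_⟩
  have h3 : eLpNorm a 3 volume ^ 3 ≤ eLpNorm a ⊤ volume * eLpNorm a 2 volume ^ 2 :=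
    eLpNorm_three_pow_le hmeas0
  have htop : eLpNorm a ⊤ volume ≤ ENNReal.ofReal C₀ := eLpNorm_top_le_of_bound hbd0
  have hfin : eLpNorm a ⊤ volume * eLpNorm a 2 volume ^ 2 < ⊤ :=
    ENNReal.mul_lt_top (htop.trans_lt ENNReal.ofReal_lt_top) (ENNReal.pow_lt_top hu2.eLpNorm_lt_top)
  by_contra hnot
  rw [not_lt, top_le_iff] at hnot
  rw [hnot, ENNReal.top_pow (by norm_num)] at h3
  exact absurd (h3.trans_lt hfin) (lt_irrefl _)

/-- **Global classical bounded-energy solutions from rapidly decaying data are global Kato solutions.** On every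
`[0, T]` the solution is Leray–Hopf (Tao 2011, Lemma 8.1 with Lemma 4.1 (i): tree
`IsClassicalNSSolutionOn.isLerayHopfOn_of_finiteEnergy` with its three facts discharged), hence a Kato `C_t L³`
solution on `[0, T)` (Lemarié-Rieusset 2016 Thm 15.1: tree `isKatoSolutionOn_of_classical`); so
`T_max^{Kato} = ∞` and the Kato solutions glue under `kato_unique`
(`hasGlobalKatoSolution_of_katoMaximalTime_eq_top`). [cite: Tao2011, Lemma 8.1 + Lemma 4.1 (i)] -/
theorem hasGlobalKatoSolution_of_global_classical
    {u : ℝ → EuclideanSpace ℝ (Fin 3) → EuclideanSpace ℝ (Fin 3)} {p : ℝ → EuclideanSpace ℝ (Fin 3) → ℝ}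
    (hcl : IsClassicalNSSolutionOn (Ici 0) 1 0 u p) (hE : HasBoundedEnergy u)
    (hdec : HasRapidSpatialDecay (u 0)) : HasGlobalKatoSolution 1 (u 0) := by
  refine hasGlobalKatoSolution_of_katoMaximalTime_eq_top kato_unique_holds one_pos ?_
  refine ENNReal.eq_top_of_forall_nnreal_le fun r => ?_
  set T : ℝ := (r : ℝ) + 1 with hT_def
  have hT : 0 < T := by positivity
  have hIcc : IsClassicalNSSolutionOn (Icc 0 T) 1 0 u p :=
    hcl.mono Icc_subset_Ici_self (uniqueDiffOn_Icc hT)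
  have hIco : IsClassicalNSSolutionOn (Ico 0 T) 1 0 u p :=
    hcl.mono Ico_subset_Ici_self (uniqueDiffOn_Ico 0 T)
  have hfe : ∃ A : ℝ≥0∞, A < ⊤ ∧ ∀ t ∈ Icc 0 T, ∫⁻ x, ‖u t x‖ₑ ^ 2 ≤ A := by
    obtain ⟨C, hC, hCt⟩ := hE
    exact ⟨C, hC, fun t ht => hCt t ht.1⟩
  have hLH : IsLerayHopfOn T 1 0 (u 0) u :=
    (hIcc.isLerayHopfOn_of_finiteEnergy tao_pressure_normalisation_holds
      tao2011_pressureTerm_estimate_holds tao_finite_energy_smooth_energy_bound_holds one_pos hT hfe).1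
  have hK : IsKatoSolutionOn T 1 (u 0) u := isKatoSolutionOn_of_classical one_pos hT hIco hLH hdec
  calc ((r : ℝ≥0) : ℝ≥0∞) = ENNReal.ofReal (r : ℝ) := (ENNReal.ofReal_coe_nnreal).symm
    _ ≤ ENNReal.ofReal T := ENNReal.ofReal_le_ofReal (by linarith)
    _ ≤ katoMaximalTime 1 (u 0) := hK.ofReal_le_katoMaximalTime

/-- **A swirl-free axisymmetric Schwartz-class datum has a global Kato solution** (LUY + the glue above).
[cite: LemarieRieusset2016, Thm. 10.4 (p. 285)] -/
theorem hasGlobalKatoSolution_of_axisym_noSwirl {u₀ : EuclideanSpace ℝ (Fin 3) → EuclideanSpace ℝ (Fin 3)}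
    (hsm : ContDiff ℝ ∞ u₀) (hdiv : VectorCalculus.IsDivFree u₀) (hdec : HasRapidSpatialDecay u₀)
    (hA : IsAxisymmetric u₀) (hS : HasNoSwirl u₀) : HasGlobalKatoSolution 1 u₀ := by
  obtain ⟨u, p, hcl, hu0, hE, -⟩ :=
    axisymmetric_no_swirl_global_regularity_holds 1 one_pos u₀ hsm hdiv hdec hA hS
  subst hu0
  exact hasGlobalKatoSolution_of_global_classical hcl hE hdec

/-- **Every smooth divergence-free rapidly decaying datum `L³`-close to a global Kato datum has a global
classical bounded-energy solution** (GIP 2003 Thm 0.1 = tree `GIP2003_L3_stability_holds`; Kato ⇒ Clay = tree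
`clay_solution_of_hasGlobalKatoSolution_holds`). [cite: GallagherIftimiePlanchon2003, Thm. 0.1 (p. 1389)] -/
theorem exists_L3_ball_global_classical_of_hasGlobalKatoSolution
    {u₀ : EuclideanSpace ℝ (Fin 3) → EuclideanSpace ℝ (Fin 3)}
    (hsm : ContDiff ℝ ∞ u₀) (hdiv : VectorCalculus.IsDivFree u₀) (hdec : HasRapidSpatialDecay u₀)
    (hK : HasGlobalKatoSolution 1 u₀) :
    ∃ ε : ℝ, 0 < ε ∧
      ∀ a : EuclideanSpace ℝ (Fin 3) → EuclideanSpace ℝ (Fin 3),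
        ContDiff ℝ ∞ a → VectorCalculus.IsDivFree a → HasRapidSpatialDecay a →
        eLpNorm (a - u₀) 3 volume < ENNReal.ofReal ε →
        ∃ (U : ℝ → EuclideanSpace ℝ (Fin 3) → EuclideanSpace ℝ (Fin 3))
          (P : ℝ → EuclideanSpace ℝ (Fin 3) → ℝ),
          IsClassicalNSSolutionOn (Ici 0) 1 0 U P ∧ U 0 = a ∧ HasBoundedEnergy U := by
  have hu3 : MemLp u₀ 3 volume := memLp_three_of_contDiff_of_hasRapidSpatialDecay hsm hdec
  have hwdiv : IsWeaklyDivFree u₀ :=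
    VectorCalculus.IsDivFree.isWeaklyDivFree_holds hdiv (hsm.of_le (mod_cast le_top))
  obtain ⟨ε, hε, hball⟩ :=
    GIP2003_L3_stability.exists_ball_hasGlobalKatoSolution_one GIP2003_L3_stability_holds hu3 hwdiv hK
  refine ⟨ε, hε, fun a ha hadiv hadec hlt => ?_⟩
  have ha3 : MemLp a 3 volume := memLp_three_of_contDiff_of_hasRapidSpatialDecay ha hadec
  have hawdiv : IsWeaklyDivFree a :=
    VectorCalculus.IsDivFree.isWeaklyDivFree_holds hadiv (ha.of_le (mod_cast le_top))
  have hlt' : eLpNorm (u₀ - a) 3 volume < ENNReal.ofReal ε := by rwa [eLpNorm_sub_comm]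
  have hKa : HasGlobalKatoSolution 1 a := hball a ha3 hawdiv hlt'
  have hdiv' : NSWave0.IsDivFree a := fun x => hadiv x
  obtain ⟨U, P, hU, hP, hns, hEU⟩ :=
    clay_solution_of_hasGlobalKatoSolution_holds 1 one_pos a ha hdiv' hadec hKa
  obtain ⟨hclU, hU0⟩ := isNavierStokesSolution_and_smooth_iff.1 ⟨hns, hU, hP⟩
  exact ⟨U, P, hclU, hU0, hEU⟩

/-- **GLOBAL REGULARITY IS OPEN IN `L³` AROUND EVERY SWIRL-FREE AXISYMMETRIC DATUM**: for `u₀` smooth, divergence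
free, rapidly decaying, axisymmetric without swirl there is `ε > 0` such that every smooth divergence-free rapidly
decaying `a` (no symmetry) with `‖a − u₀‖_{L³} < ε` has a global classical bounded-energy solution of the
unit-viscosity unforced Navier–Stokes system with datum `a`. (= stub S2 `SterileGlobalOpenT` of
`Cruxes/EpisodeBase/Lines/robustmirror.lean`, verbatim.) [cite: GallagherIftimiePlanchon2003, Thm. 0.1 (p. 1389)] -/
theorem exists_L3_ball_global_classical_of_axisym_noSwirl :
    ∀ u₀ : EuclideanSpace ℝ (Fin 3) → EuclideanSpace ℝ (Fin 3),
    ContDiff ℝ ∞ u₀ → VectorCalculus.IsDivFree u₀ → HasRapidSpatialDecay u₀ →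
    IsAxisymmetric u₀ → HasNoSwirl u₀ →
    ∃ ε : ℝ, 0 < ε ∧
      ∀ a : EuclideanSpace ℝ (Fin 3) → EuclideanSpace ℝ (Fin 3),
        ContDiff ℝ ∞ a → VectorCalculus.IsDivFree a → HasRapidSpatialDecay a →
        eLpNorm (a - u₀) 3 volume < ENNReal.ofReal ε →
        ∃ (U : ℝ → EuclideanSpace ℝ (Fin 3) → EuclideanSpace ℝ (Fin 3))
          (P : ℝ → EuclideanSpace ℝ (Fin 3) → ℝ),
          IsClassicalNSSolutionOn (Ici 0) 1 0 U P ∧ U 0 = a ∧ HasBoundedEnergy U :=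
  fun _ hsm hdiv hdec hA hS =>
    exists_L3_ball_global_classical_of_hasGlobalKatoSolution hsm hdiv hdec
      (hasGlobalKatoSolution_of_axisym_noSwirl hsm hdiv hdec hA hS)

end Summit.NavierStokesRegularity.SterileGlobalOpenL3

end
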